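import Literature.Barriers.ResolutionOfSingularities.ResidualOrderUnboundedBounds
import Literature.Barriers.ResolutionOfSingularities.KangarooShadeIncrease
import Literature.AlgebraicGeometry.Resolution.PointBlowupShadeCentres
import Mathlib.Algebra.MvPolynomial.PDeriv
import Mathlib.RingTheory.MvPowerSeries.NoZeroDivisors
import Mathlib.Algebra.CharP.Lemmas
import HarnessLib

/-!
# Order of a two-term polynomial at a `K`-point (the «toric-exactness» lemma)

For `G = c₁·x^A + c₂·x^B` over a field `K` and a `K`-point `ξ` with zero pattern `S = {i : ξᵢ = 0}`, the order of `G` at `ξ`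
(= `ord₀` of the translate `G(x + ξ)`, `Hauser2010.ordZero`) is governed by the restrictions `A_S`, `B_S` of the exponents to `S`:
* it is always `≥ min(|A_S|, |B_S|) = ordAlong S G` (`CentreBlowup.ordAlong`, Hauser–Perlega's `ord_P`), and
* it EQUALS `min(|A_S|, |B_S|)` whenever `A_S ≠ B_S` (in particular whenever `|A_S| ≠ |B_S|`): two different monomials of the
  translate cannot cancel;
* when `A_S = B_S` it equals `|A_S|` unless the unit combination `c₁ ξ^{A'} + c₂ ξ^{B'}` vanishes (the only way a binomial's
  order locus can leave the torus-invariant strata); there it jumps, and (rev 2, §4) the jump is EXACTLY one as soon as some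
  `Aᵢ − Bᵢ` (`i ∉ S`) is non-zero in `K` (`p ∤ Aᵢ − Bᵢ`); in general (rev 3, §5, characteristic `p`) the jump is EXACTLY `p^v`
  where `p^v` is the largest power of `p` dividing all `Aᵢ − Bᵢ`, `i ∉ S` (off-`S` parts `A' = m + p^v F⁺`, `B' = m + p^v F⁻`
  with some `F⁺ᵢ − F⁻ᵢ` prime to `p`): `c₁x^{p^vF⁺} + c₂x^{p^vF⁻} = c₁ (x^{F⁺} − ρ x^{F⁻})^{p^v}`.
So the top locus `{ord ≥ q}` of `z^q + G` is EXACTLY the union of the coordinate strata `C_S` with `q ≤ ordAlong S G` unless some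
cancellation pattern `S` (`A_S = B_S`) has `|A_S| < q ≤ |A_S| + p^{v(S)}` — the complete «toric guard» under which exponent
bookkeeping IS the geometry of binomial data; §6 (rev 4) packages the jump-one form of this criterion as one `iff` per `K`-point
(`natCast_le_ordZero_translate_iff_of_guard`); §7 (rev 5) gives the decidable sufficient condition used on explicit members: one
coordinate with `(Aᵢ : K) ≠ Bᵢ` plus agreement mass `Σ_{i : Aᵢ = Bᵢ} Aᵢ + 1 < q` (`natCast_le_ordZero_translate_iff_of_apply_ne`).

HONEST FRAMING. Elementary commutative algebra (Taylor expansion of monomials), written for the RESCUE bed of the Hironaka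
campaign (D-0124) where many cells read top loci of binomial data `z^q + m₁ + m₂` through `ordAlong` (Hauser–Perlega's `ord_P`,
[cite: HauserPerlega2019PRIMS, §2]; order at a point as in [cite: Hauser2010, §C]). Nothing here concerns H. Hironaka's manuscript.
Written by res-D-pv-001. Standard axioms only; no `sorry`; 0 defs (the translate is spelt `aeval (fun i => X i + C (ξ i))`).

## Sources
* H. Hauser, Bull. AMS 47 (2010), §C (order of a hypersurface at a point = order of the Taylor expansion). [cite: Hauser2010, §C]
* H. Hauser, S. Perlega, PRIMS survey, §2 (`ord_P` along coordinate subspaces). [cite: HauserPerlega2019PRIMS, §2]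
-/

noncomputable section

open MvPolynomial Finset

open scoped BigOperators

namespace Literature.AlgebraicGeometry.Resolution

namespace BinomialPointOrder

open Literature.AlgebraicGeometry.Resolution.Hauser2010
open Literature.Barriers.ResolutionOfSingularities
open Literature.Barriers.ResolutionOfSingularities.HauserPerlega (le_ordZero_of_forall_mem_support)

variable {σ : Type*} [DecidableEq σ] {K : Type*} [Field K]

/-! ## §1 The translate of a monomial: `x^A ↦ x^{A_S} · R_A` with `R_A(0) = ξ^{A'} ≠ 0` -/

/-- The restriction `A_S` of an exponent vector to the coordinates in `S` (those vanishing at the point). [folklore] -/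
private theorem filter_apply_mem {S : Finset σ} {A : σ →₀ ℕ} {i : σ} (hi : i ∈ S) :
    (A.filter (· ∈ S)) i = A i := by
  rw [Finsupp.filter_apply, if_pos hi]

/-- `|A_S| = degIn S A`: the total degree of the restriction of an exponent to `S` is Hauser–Perlega's `S`-degree (the exponent of
`ord_P`). [cite: HauserPerlega2019PRIMS, §2 (ord_P)] -/
theorem degree_filter_eq_degIn (S : Finset σ) (A : σ →₀ ℕ) :
    (A.filter (· ∈ S)).degree = CentreBlowup.degIn S A := by
  classical
  rw [CentreBlowup.degIn]
  show ∑ i ∈ (A.filter (· ∈ S)).support, (A.filter (· ∈ S)) i = ∑ i ∈ S, A i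
  rw [Finsupp.support_filter]
  have h1 : ∑ i ∈ A.support.filter (· ∈ S), (A.filter (· ∈ S)) i = ∑ i ∈ A.support.filter (· ∈ S), A i :=
    Finset.sum_congr rfl fun i hi => by rw [Finset.mem_filter] at hi; rw [filter_apply_mem hi.2]
  rw [h1]
  apply Finset.sum_subset_zero_on_sdiff
  · intro i hi; rw [Finset.mem_filter] at hi; exact hi.2
  · intro i hi
    rw [Finset.mem_sdiff, Finset.mem_filter, not_and'] at hi
    have := hi.2 hi.1
    simpa [Finsupp.mem_support_iff] using this
  · intro i _; rfl

/-- **Taylor factorisation of a monomial at `ξ`**: `x^A(x + ξ) = x^{A_S} · R_A` with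
`R_A = C c · ∏_{i ∉ S} (xᵢ + ξᵢ)^{Aᵢ}`, when `ξᵢ = 0` for `i ∈ S`. [cite: Hauser2010, §C] -/
theorem aeval_translate_monomial (ξ : σ → K) (S : Finset σ) (hS : ∀ i ∈ S, ξ i = 0) (A : σ →₀ ℕ) (c : K) :
    aeval (fun i => X i + C (ξ i)) (monomial A c) =
      monomial (A.filter (· ∈ S)) 1 *
        (C c * ∏ i ∈ A.support.filter (· ∉ S), (X i + C (ξ i)) ^ (A i)) := by
  classical
  rw [aeval_monomial, Finsupp.prod, ← Finset.prod_filter_mul_prod_filter_not A.support (· ∈ S)]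
  have h1 : ∏ i ∈ A.support.filter (· ∈ S), (X i + C (ξ i)) ^ (A i) =
      (monomial (A.filter (· ∈ S)) (1 : K)) := by
    rw [monomial_eq, C_1, one_mul, Finsupp.prod, Finsupp.support_filter]
    refine Finset.prod_congr rfl fun i hi => ?_
    rw [Finset.mem_filter] at hi
    rw [hS i hi.2, C_0, add_zero, filter_apply_mem hi.2]
  rw [h1, MvPolynomial.algebraMap_eq]; ring

/-- The cofactor `R_A` of the Taylor factorisation has constant coefficient `c · ∏_{i∉S} ξᵢ^{Aᵢ}` (the value of `x^{A'}` at `ξ`).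
[cite: Hauser2010, §C] -/
theorem constantCoeff_cofactor (ξ : σ → K) (S : Finset σ) (A : σ →₀ ℕ) (c : K) :
    constantCoeff (C c * ∏ i ∈ A.support.filter (· ∉ S), (X i + C (ξ i)) ^ (A i)) =
      c * ∏ i ∈ A.support.filter (· ∉ S), (ξ i) ^ (A i) := by
  rw [map_mul, constantCoeff_C, map_prod]
  congr 1
  refine Finset.prod_congr rfl fun i _ => ?_
  rw [map_pow, map_add, constantCoeff_X, constantCoeff_C, zero_add]

/-- … and that constant is non-zero when `c ≠ 0` and `ξᵢ ≠ 0` off `S` (a monomial does not vanish at a point of the torus of the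
complementary coordinates). [cite: Hauser2010, §C] -/
theorem constantCoeff_cofactor_ne_zero (ξ : σ → K) (S : Finset σ) (hS' : ∀ i, i ∉ S → ξ i ≠ 0) (A : σ →₀ ℕ)
    {c : K} (hc : c ≠ 0) :
    constantCoeff (C c * ∏ i ∈ A.support.filter (· ∉ S), (X i + C (ξ i)) ^ (A i)) ≠ 0 := by
  rw [constantCoeff_cofactor]
  refine mul_ne_zero hc (Finset.prod_ne_zero_iff.mpr fun i hi => ?_)
  rw [Finset.mem_filter] at hi
  exact pow_ne_zero _ (hS' i hi.2)

/-! ## §2 Coefficients of `x^{A_S} · R` -/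

omit [DecidableEq σ] in
/-- Every monomial of `x^m · R` is `≥ m` componentwise, hence has degree `≥ |m|`. [folklore] -/
private theorem degree_le_of_mem_support_monomial_mul (m : σ →₀ ℕ) (R : MvPolynomial σ K) {e : σ →₀ ℕ}
    (he : e ∈ (monomial m (1 : K) * R).support) : m.degree ≤ e.degree := by
  classical
  rw [MvPolynomial.mem_support_iff, coeff_monomial_mul'] at he
  by_cases hle : m ≤ e
  · -- degree is monotone
    have : e = m + (e - m) := (add_tsub_cancel_of_le hle).symm
    rw [this, map_add]; exact Nat.le_add_right _ _
  · rw [if_neg hle] at he; exact absurd rfl he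

omit [DecidableEq σ] in
/-- The coefficient of `x^m` itself in `x^m · R` is `R(0)`. [folklore] -/
private theorem coeff_self_monomial_mul (m : σ →₀ ℕ) (R : MvPolynomial σ K) :
    coeff m (monomial m (1 : K) * R) = constantCoeff R := by
  classical
  rw [coeff_monomial_mul', if_pos le_rfl, one_mul, tsub_self, ← constantCoeff_eq]

omit [DecidableEq σ] in
/-- The coefficient of `x^m` in `x^{m'} · R` vanishes unless `m' ≤ m`. [folklore] -/
private theorem coeff_monomial_mul_of_not_le {m m' : σ →₀ ℕ} (h : ¬ m' ≤ m) (R : MvPolynomial σ K) :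
    coeff m (monomial m' (1 : K) * R) = 0 := by
  classical
  rw [coeff_monomial_mul', if_neg h]

omit [DecidableEq σ] in
/-- Two exponent vectors with `m' ≤ m` and `|m| ≤ |m'|` are equal. [folklore] -/
private theorem eq_of_le_of_degree_le {m m' : σ →₀ ℕ} (h : m' ≤ m) (hd : m.degree ≤ m'.degree) : m' = m := by
  classical
  have : m = m' + (m - m') := (add_tsub_cancel_of_le h).symm
  have hdeg : (m - m').degree = 0 := by
    have h2 := congrArg Finsupp.degree this
    rw [map_add] at h2; omega
  rw [Finsupp.degree_eq_zero_iff] at hdeg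
  rw [this, hdeg, add_zero]

/-! ## §3 The order of a binomial at a point -/

/-- **Lower bound.** At any `K`-point `ξ` vanishing on `S`, `ord_ξ (c₁x^A + c₂x^B) ≥ min(|A_S|, |B_S|)` (`= ordAlong S` for unit
coefficients). [cite: Hauser2010, §C] [cite: HauserPerlega2019PRIMS, §2 (ord_P)] -/
theorem min_degIn_le_ordZero_translate (ξ : σ → K) (S : Finset σ) (hS : ∀ i ∈ S, ξ i = 0) (A B : σ →₀ ℕ) (c₁ c₂ : K) :
    ((min (CentreBlowup.degIn S A) (CentreBlowup.degIn S B) : ℕ) : ℕ∞) ≤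
      ordZero (aeval (fun i => X i + C (ξ i)) (monomial A c₁ + monomial B c₂)) := by
  classical
  rw [map_add, aeval_translate_monomial ξ S hS A c₁, aeval_translate_monomial ξ S hS B c₂]
  refine le_ordZero_of_forall_mem_support fun e he => ?_
  rcases Finset.mem_union.mp (MvPolynomial.support_add he) with h | h
  · have := degree_le_of_mem_support_monomial_mul _ _ h
    rw [degree_filter_eq_degIn] at this; omega
  · have := degree_le_of_mem_support_monomial_mul _ _ h
    rw [degree_filter_eq_degIn] at this; omega

/-- **Exactness off the cancellation pattern.** If the zero pattern of `ξ` is exactly `S` and the restrictions `A_S ≠ B_S` differ,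
then `ord_ξ (c₁x^A + c₂x^B) = min(|A_S|, |B_S|)` for `c₁, c₂ ≠ 0`: the translate contains the monomial `x^{A_S}` (say `|A_S| ≤ |B_S|`)
with coefficient `c₁ ξ^{A'} ≠ 0`, and `x^{B_S}·R_B` cannot contribute to it. [cite: Hauser2010, §C] [cite: HauserPerlega2019PRIMS, §2 (ord_P)] -/
theorem ordZero_translate_binomial_eq (ξ : σ → K) (S : Finset σ) (hS : ∀ i ∈ S, ξ i = 0) (hS' : ∀ i, i ∉ S → ξ i ≠ 0)
    {A B : σ →₀ ℕ} (hAB : A.filter (· ∈ S) ≠ B.filter (· ∈ S)) (hle : CentreBlowup.degIn S A ≤ CentreBlowup.degIn S B)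
    {c₁ c₂ : K} (hc₁ : c₁ ≠ 0) :
    ordZero (aeval (fun i => X i + C (ξ i)) (monomial A c₁ + monomial B c₂)) = CentreBlowup.degIn S A := by
  classical
  apply le_antisymm
  · rw [map_add, aeval_translate_monomial ξ S hS A c₁, aeval_translate_monomial ξ S hS B c₂]
    have hcoeff : coeff (A.filter (· ∈ S))
        (monomial (A.filter (· ∈ S)) (1 : K) * (C c₁ * ∏ i ∈ A.support.filter (· ∉ S), (X i + C (ξ i)) ^ (A i)) +
          monomial (B.filter (· ∈ S)) (1 : K) * (C c₂ * ∏ i ∈ B.support.filter (· ∉ S), (X i + C (ξ i)) ^ (B i))) ≠ 0 := by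
      rw [coeff_add, coeff_self_monomial_mul, coeff_monomial_mul_of_not_le, add_zero]
      · exact constantCoeff_cofactor_ne_zero ξ S hS' A hc₁
      · intro hBA
        apply hAB
        refine (eq_of_le_of_degree_le hBA ?_).symm
        rw [degree_filter_eq_degIn, degree_filter_eq_degIn]; exact hle
    have := ordZero_le_of_coeff_ne_zero _ _ hcoeff
    rwa [degree_filter_eq_degIn] at this
  · have := min_degIn_le_ordZero_translate ξ S hS A B c₁ c₂
    rwa [min_eq_left hle] at this

/-- **Exactness on the cancellation pattern, off the cancellation hypersurface.** If `A_S = B_S` but the unit combination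
`c₁ ∏_{i∉S} ξᵢ^{Aᵢ} + c₂ ∏_{i∉S} ξᵢ^{Bᵢ}` is non-zero, the order is still `|A_S|`. [cite: Hauser2010, §C] -/
theorem ordZero_translate_binomial_eq_of_sum_ne_zero (ξ : σ → K) (S : Finset σ) (hS : ∀ i ∈ S, ξ i = 0)
    {A B : σ →₀ ℕ} (hAB : A.filter (· ∈ S) = B.filter (· ∈ S)) (c₁ c₂ : K)
    (hsum : c₁ * ∏ i ∈ A.support.filter (· ∉ S), (ξ i) ^ (A i) + c₂ * ∏ i ∈ B.support.filter (· ∉ S), (ξ i) ^ (B i) ≠ 0) :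
    ordZero (aeval (fun i => X i + C (ξ i)) (monomial A c₁ + monomial B c₂)) = CentreBlowup.degIn S A := by
  classical
  have hdeg : CentreBlowup.degIn S A = CentreBlowup.degIn S B := by
    rw [← degree_filter_eq_degIn, ← degree_filter_eq_degIn, hAB]
  apply le_antisymm
  · rw [map_add, aeval_translate_monomial ξ S hS A c₁, aeval_translate_monomial ξ S hS B c₂, ← hAB]
    have hcoeff : coeff (A.filter (· ∈ S))
        (monomial (A.filter (· ∈ S)) (1 : K) * (C c₁ * ∏ i ∈ A.support.filter (· ∉ S), (X i + C (ξ i)) ^ (A i)) +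
          monomial (A.filter (· ∈ S)) (1 : K) * (C c₂ * ∏ i ∈ B.support.filter (· ∉ S), (X i + C (ξ i)) ^ (B i))) ≠ 0 := by
      rw [coeff_add, coeff_self_monomial_mul, coeff_self_monomial_mul, constantCoeff_cofactor, constantCoeff_cofactor]
      exact hsum
    have := ordZero_le_of_coeff_ne_zero _ _ hcoeff
    rwa [degree_filter_eq_degIn] at this
  · have := min_degIn_le_ordZero_translate ξ S hS A B c₁ c₂
    rwa [← hdeg, min_self] at this

/-- **The cancellation hypersurface is special.** If `A_S = B_S` and the unit combination VANISHES at `ξ`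
(`c₁ ∏_{i∉S} ξᵢ^{Aᵢ} + c₂ ∏_{i∉S} ξᵢ^{Bᵢ} = 0`), the order JUMPS: `ord_ξ (c₁x^A + c₂x^B) ≥ |A_S| + 1` — so when `|A_S| = q − 1` such
points lie in the top locus `{ord ≥ q}` of `z^q + G` although no torus-invariant stratum through them does (e.g. `q = 2`,
`G = x + xy` at `(0, −1)`): the exact «toric guard» must exclude `A_S = B_S ∧ |A_S| < q ≤ |A_S| + (jump)`, not only `p`-th-power
ratios. [cite: Hauser2010, §C] -/
theorem succ_degIn_le_ordZero_translate_of_sum_eq_zero (ξ : σ → K) (S : Finset σ) (hS : ∀ i ∈ S, ξ i = 0)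
    {A B : σ →₀ ℕ} (hAB : A.filter (· ∈ S) = B.filter (· ∈ S)) (c₁ c₂ : K)
    (hsum : c₁ * ∏ i ∈ A.support.filter (· ∉ S), (ξ i) ^ (A i) + c₂ * ∏ i ∈ B.support.filter (· ∉ S), (ξ i) ^ (B i) = 0) :
    ((CentreBlowup.degIn S A + 1 : ℕ) : ℕ∞) ≤ ordZero (aeval (fun i => X i + C (ξ i)) (monomial A c₁ + monomial B c₂)) := by
  classical
  rw [map_add, aeval_translate_monomial ξ S hS A c₁, aeval_translate_monomial ξ S hS B c₂, ← hAB]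
  set RA := C c₁ * ∏ i ∈ A.support.filter (· ∉ S), (X i + C (ξ i)) ^ (A i) with hRA
  set RB := C c₂ * ∏ i ∈ B.support.filter (· ∉ S), (X i + C (ξ i)) ^ (B i) with hRB
  have hzero : coeff (A.filter (· ∈ S)) (monomial (A.filter (· ∈ S)) (1 : K) * RA + monomial (A.filter (· ∈ S)) (1 : K) * RB) = 0 := by
    rw [coeff_add, coeff_self_monomial_mul, coeff_self_monomial_mul, hRA, hRB, constantCoeff_cofactor, constantCoeff_cofactor]
    exact hsum
  refine le_ordZero_of_forall_mem_support fun e he => ?_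
  have hge : (A.filter (· ∈ S)) ≤ e := by
    rcases Finset.mem_union.mp (MvPolynomial.support_add he) with h | h <;>
    · rw [MvPolynomial.mem_support_iff, coeff_monomial_mul'] at h
      by_contra hle; rw [if_neg hle] at h; exact h rfl
  have hdeg : (A.filter (· ∈ S)).degree ≤ e.degree := by
    have : e = A.filter (· ∈ S) + (e - A.filter (· ∈ S)) := (add_tsub_cancel_of_le hge).symm
    rw [this, map_add]; exact Nat.le_add_right _ _
  rw [← degree_filter_eq_degIn]
  by_contra hlt
  push Not at hlt
  have heq : e.degree ≤ (A.filter (· ∈ S)).degree := by omega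
  have := eq_of_le_of_degree_le hge heq
  rw [← this] at he
  exact (MvPolynomial.mem_support_iff.mp he) hzero

/-! ## §4 (rev 2) The size of the jump off `p`-divisibility: exactly one -/

omit [DecidableEq σ] in
/-- The linear coefficient along `xᵢ` is the constant term of `∂ᵢ`. [folklore] -/
private theorem constantCoeff_pderiv (i : σ) (f : MvPolynomial σ K) :
    constantCoeff (pderiv i f) = coeff (Finsupp.single i 1) f := by
  classical
  conv_lhs => rw [f.as_sum]
  conv_rhs => rw [f.as_sum]
  rw [map_sum, map_sum, coeff_sum]
  refine Finset.sum_congr rfl fun e _ => ?_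
  rw [pderiv_monomial, constantCoeff_monomial, coeff_monomial]
  by_cases h1 : e = Finsupp.single i 1
  · subst h1; simp
  · rw [if_neg h1]
    by_cases h0 : e - Finsupp.single i 1 = 0
    · rw [if_pos h0]
      -- e ≤ single i 1 and e ≠ single i 1 ⇒ e i = 0
      have hle : e ≤ Finsupp.single i 1 := tsub_eq_zero_iff_le.mp h0
      have hei : e i = 0 := by
        have := hle i
        rw [Finsupp.single_eq_same] at this
        rcases Nat.le_one_iff_eq_zero_or_eq_one.mp this with h | h
        · exact h
        · exfalso; apply h1; ext j
          by_cases hj : j = i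
          · subst hj; rw [Finsupp.single_eq_same]; exact h
          · have := hle j; rw [Finsupp.single_eq_of_ne hj] at this ⊢; omega
      rw [hei, Nat.cast_zero, mul_zero]
    · rw [if_neg h0]

/-- `∂ᵢ (xⱼ + a)^n` has constant term `n·a^{n−1}` if `i = j`, else `0`. [folklore] -/
private theorem constantCoeff_pderiv_X_add_C_pow (i j : σ) (a : K) (n : ℕ) :
    constantCoeff (pderiv i ((X j + C a) ^ n)) = if j = i then (n : K) * a ^ (n - 1) else 0 := by
  classical
  rw [(pderiv i).leibniz_pow, map_add, pderiv_C, add_zero, pderiv_X]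
  rw [smul_eq_mul, nsmul_eq_mul, map_mul, map_mul, map_natCast, map_pow, map_add, constantCoeff_X, constantCoeff_C, zero_add]
  by_cases h : j = i
  · subst h; simp [Pi.single_eq_same]
  · rw [if_neg h, Pi.single_eq_of_ne h, map_zero, mul_zero, mul_zero]

/-- **The linear Taylor coefficients of the cofactor**: for `i ∉ S`,
`ξᵢ · [xᵢ] R_A = Aᵢ · R_A(0)` where `R_A = C c · ∏_{j∉S} (xⱼ + ξⱼ)^{Aⱼ}`. [cite: Hauser2010, §C] -/
theorem mul_coeff_single_cofactor (ξ : σ → K) (S : Finset σ) (A : σ →₀ ℕ) (c : K) {i : σ} (hi : i ∉ S) (hξ : ξ i ≠ 0) :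
    ξ i * coeff (Finsupp.single i 1) (C c * ∏ j ∈ A.support.filter (· ∉ S), (X j + C (ξ j)) ^ (A j)) =
      (A i : K) * constantCoeff (C c * ∏ j ∈ A.support.filter (· ∉ S), (X j + C (ξ j)) ^ (A j)) := by
  classical
  rw [← constantCoeff_pderiv, (pderiv i).leibniz, pderiv_C, smul_zero, add_zero, smul_eq_mul, map_mul,
    map_mul, constantCoeff_C]
  -- Leibniz over the product
  set T := A.support.filter (· ∉ S) with hT
  have key : ∀ U : Finset σ, ξ i * constantCoeff (pderiv i (∏ j ∈ U, (X j + C (ξ j)) ^ (A j))) =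
      (if i ∈ U then (A i : K) else 0) * constantCoeff (∏ j ∈ U, (X j + C (ξ j)) ^ (A j)) := by
    intro U
    induction U using Finset.induction_on with
    | empty => simp
    | insert j U hj ih =>
      have hconst : constantCoeff ((X j + C (ξ j)) ^ (A j)) = ξ j ^ (A j) := by
        rw [map_pow, map_add, constantCoeff_X, constantCoeff_C, zero_add]
      rw [Finset.prod_insert hj, (pderiv i).leibniz, map_add, smul_eq_mul, smul_eq_mul, map_mul, map_mul,
        mul_add, constantCoeff_pderiv_X_add_C_pow, hconst]
      by_cases hji : j = i
      · subst hji
        rw [if_pos rfl, if_pos (Finset.mem_insert_self j U), map_mul, hconst]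
        rw [if_neg hj] at ih
        have ih' : ξ j * constantCoeff (pderiv j (∏ x ∈ U, (X x + C (ξ x)) ^ (A x))) = 0 := by
          rw [ih, zero_mul]
        have hA : (A j : K) * ξ j ^ (A j - 1) * ξ j = (A j : K) * ξ j ^ (A j) := by
          rcases Nat.eq_zero_or_pos (A j) with h0 | hpos
          · rw [h0]; simp
          · rw [mul_assoc, ← pow_succ, Nat.sub_add_cancel hpos]
        calc ξ j * (ξ j ^ A j * constantCoeff (pderiv j (∏ x ∈ U, (X x + C (ξ x)) ^ A x))) +
              ξ j * (constantCoeff (∏ x ∈ U, (X x + C (ξ x)) ^ A x) * ((A j : K) * ξ j ^ (A j - 1)))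
            = ξ j ^ A j * (ξ j * constantCoeff (pderiv j (∏ x ∈ U, (X x + C (ξ x)) ^ A x))) +
              ((A j : K) * ξ j ^ (A j - 1) * ξ j) * constantCoeff (∏ x ∈ U, (X x + C (ξ x)) ^ A x) := by ring
          _ = (A j : K) * (ξ j ^ A j * constantCoeff (∏ x ∈ U, (X x + C (ξ x)) ^ A x)) := by
            rw [ih', hA]; ring
      · rw [if_neg hji, mul_zero, mul_zero, add_zero]
        have hins : (if i ∈ insert j U then (A i : K) else 0) = if i ∈ U then (A i : K) else 0 := by
          by_cases hu : i ∈ U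
          · rw [if_pos hu, if_pos (Finset.mem_insert_of_mem hu)]
          · rw [if_neg hu, if_neg (fun h => (Finset.mem_insert.mp h).elim (fun h' => hji h'.symm) hu)]
        rw [hins, ← mul_assoc, mul_comm (ξ i), mul_assoc, ih, map_mul, hconst]; ring
  rw [← mul_assoc, mul_comm (ξ i) c, mul_assoc, key T]
  by_cases hiT : i ∈ T
  · rw [if_pos hiT]; ring
  · rw [if_neg hiT, zero_mul, mul_zero]
    have hA0 : A i = 0 := by
      rw [hT, Finset.mem_filter, not_and'] at hiT
      have := hiT hi
      simpa [Finsupp.mem_support_iff] using this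
    rw [hA0, Nat.cast_zero, zero_mul]


/-- **The jump is exactly one off `p`-divisibility.** If `A_S = B_S`, the unit combination vanishes at `ξ`, `c₁ ≠ 0`, and for some
`i ∉ S` the exponents differ IN `K` (`(Aᵢ : K) ≠ Bᵢ`, i.e. `p ∤ Aᵢ − Bᵢ` in characteristic `p`), then
`ord_ξ (c₁x^A + c₂x^B) = |A_S| + 1` EXACTLY: the monomial `x^{A_S}·xᵢ` of the translate has coefficient
`(Aᵢ − Bᵢ)·c₁ξ^{A'}/ξᵢ ≠ 0`. (When every `Aᵢ − Bᵢ`, `i ∉ S`, is divisible by `p` the jump is a higher power of `p` — not treated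
here.) So a binomial engine's «toric guard» may treat a cancellation pattern with `|A_S| + 1 < q` and some `p ∤ Aᵢ − Bᵢ` as
harmless for the level-`q` top locus. [cite: Hauser2010, §C] -/
theorem ordZero_translate_binomial_eq_succ (ξ : σ → K) (S : Finset σ) (hS : ∀ i ∈ S, ξ i = 0)
    (hS' : ∀ i, i ∉ S → ξ i ≠ 0) {A B : σ →₀ ℕ} (hAB : A.filter (· ∈ S) = B.filter (· ∈ S)) {c₁ c₂ : K} (hc₁ : c₁ ≠ 0)
    (hsum : c₁ * ∏ i ∈ A.support.filter (· ∉ S), (ξ i) ^ (A i) + c₂ * ∏ i ∈ B.support.filter (· ∉ S), (ξ i) ^ (B i) = 0)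
    {i : σ} (hi : i ∉ S) (hABi : (A i : K) ≠ (B i : K)) :
    ordZero (aeval (fun i => X i + C (ξ i)) (monomial A c₁ + monomial B c₂)) = (CentreBlowup.degIn S A + 1 : ℕ) := by
  classical
  apply le_antisymm
  · rw [map_add, aeval_translate_monomial ξ S hS A c₁, aeval_translate_monomial ξ S hS B c₂, ← hAB]
    set RA := C c₁ * ∏ j ∈ A.support.filter (· ∉ S), (X j + C (ξ j)) ^ (A j) with hRA
    set RB := C c₂ * ∏ j ∈ B.support.filter (· ∉ S), (X j + C (ξ j)) ^ (B j) with hRB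
    have hκ : constantCoeff RA + constantCoeff RB = 0 := by
      rw [hRA, hRB, constantCoeff_cofactor, constantCoeff_cofactor]; exact hsum
    have hκA : constantCoeff RA ≠ 0 := by rw [hRA]; exact constantCoeff_cofactor_ne_zero ξ S hS' A hc₁
    have hcoeff : coeff (A.filter (· ∈ S) + Finsupp.single i 1)
        (monomial (A.filter (· ∈ S)) (1 : K) * RA + monomial (A.filter (· ∈ S)) (1 : K) * RB) ≠ 0 := by
      rw [coeff_add, coeff_monomial_mul', coeff_monomial_mul', if_pos le_self_add, if_pos le_self_add, one_mul, one_mul,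
        add_tsub_cancel_left]
      intro h0
      have h1 : ξ i * (coeff (Finsupp.single i 1) RA + coeff (Finsupp.single i 1) RB) =
          ((A i : K) - (B i : K)) * constantCoeff RA := by
        rw [mul_add, hRA, mul_coeff_single_cofactor ξ S A c₁ hi (hS' i hi), hRB,
          mul_coeff_single_cofactor ξ S B c₂ hi (hS' i hi), ← hRA, ← hRB]
        have : constantCoeff RB = - constantCoeff RA := eq_neg_of_add_eq_zero_right hκ
        rw [this]; ring
      rw [h0, mul_zero] at h1
      exact mul_ne_zero (sub_ne_zero.mpr hABi) hκA h1.symm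
    have := ordZero_le_of_coeff_ne_zero _ _ hcoeff
    rwa [map_add, degree_filter_eq_degIn, Finsupp.degree_single] at this
  · exact_mod_cast succ_degIn_le_ordZero_translate_of_sum_eq_zero ξ S hS hAB c₁ c₂ hsum

/-! ## §5 (rev 3) The size of the jump in general: `p^v` -/

/-! ### §5a `ord₀` plumbing over a field -/

omit [DecidableEq σ] in
/-- `ord₀ (f·g) = ord₀ f + ord₀ g` over a field. [folklore] -/
private theorem ordZero_mul (f g : MvPolynomial σ K) : ordZero (f * g) = ordZero f + ordZero g := by
  unfold ordZero; rw [MvPolynomial.coe_mul, MvPowerSeries.order_mul]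

omit [DecidableEq σ] in
/-- A polynomial with non-zero constant term has `ord₀ = 0`. [folklore] -/
private theorem ordZero_eq_zero_of_constantCoeff (f : MvPolynomial σ K) (h : constantCoeff f ≠ 0) : ordZero f = 0 := by
  have := ordZero_le_of_coeff_ne_zero f 0 (by rwa [← constantCoeff_eq])
  rw [map_zero, Nat.cast_zero] at this
  exact le_antisymm this bot_le

omit [DecidableEq σ] in
/-- `ord₀ (f^n) = n · ord₀ f` over a field. [folklore] -/
private theorem ordZero_pow (f : MvPolynomial σ K) (n : ℕ) : ordZero (f ^ n) = n * ordZero f := by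
  induction n with
  | zero =>
    rw [pow_zero, Nat.cast_zero, zero_mul]
    exact ordZero_eq_zero_of_constantCoeff _ (by rw [map_one]; exact one_ne_zero)
  | succ n ih => rw [pow_succ, ordZero_mul, ih, Nat.cast_succ, add_mul, one_mul]

omit [DecidableEq σ] in
/-- `ord₀ (x^d · c) = |d|` for `c ≠ 0`. [folklore] -/
private theorem ordZero_monomial (d : σ →₀ ℕ) {c : K} (hc : c ≠ 0) : ordZero (monomial d c) = d.degree := by
  unfold ordZero; rw [MvPolynomial.coe_monomial, MvPowerSeries.order_monomial_of_ne_zero hc]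

omit [DecidableEq σ] in
/-- The constant term of the translate is the value at `ξ`. [cite: Hauser2010, §C] -/
theorem constantCoeff_aeval_translate (ξ : σ → K) (f : MvPolynomial σ K) :
    constantCoeff (aeval (fun i => X i + C (ξ i)) f) = eval ξ f := by
  induction f using MvPolynomial.induction_on with
  | C a => rw [aeval_C, MvPolynomial.algebraMap_eq, constantCoeff_C, eval_C]
  | add p q hp hq => rw [map_add, map_add, hp, hq, map_add]
  | mul_X p i hp => rw [map_mul, map_mul, hp, aeval_X, map_add, constantCoeff_X, constantCoeff_C, zero_add, map_mul, eval_X]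


/-! ### §5b Reduction to the torus part and the exact jump `p^v` -/

omit [DecidableEq σ] in
/-- The value of a monomial supported off `S` at a point with all those coordinates non-zero is non-zero. [folklore] -/
private theorem eval_monomial_ne_zero (ξ : σ → K) (S : Finset σ) (hS' : ∀ i, i ∉ S → ξ i ≠ 0) {m : σ →₀ ℕ}
    (hm : ∀ i ∈ S, m i = 0) {c : K} (hc : c ≠ 0) : eval ξ (monomial m c) ≠ 0 := by
  classical
  rw [eval_monomial]
  refine mul_ne_zero hc (Finset.prod_ne_zero_iff.mpr fun i hi => pow_ne_zero _ (hS' i fun hiS => ?_))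
  rw [Finsupp.mem_support_iff] at hi
  exact hi (hm i hiS)

/-- The cofactor `R_A` IS the translate of the off-`S` part `x^{A'}` of the monomial (`A' = A` restricted to `Sᶜ`).
[cite: Hauser2010, §C] -/
theorem cofactor_eq_aeval_filter (ξ : σ → K) (S : Finset σ) (A : σ →₀ ℕ) (c : K) :
    C c * ∏ j ∈ A.support.filter (· ∉ S), (X j + C (ξ j)) ^ (A j) =
      aeval (fun i => X i + C (ξ i)) (monomial (A.filter (· ∉ S)) c) := by
  classical
  rw [aeval_monomial, MvPolynomial.algebraMap_eq, Finsupp.prod, Finsupp.support_filter]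
  congr 1
  refine Finset.prod_congr rfl fun j hj => ?_
  rw [Finset.mem_filter] at hj
  rw [Finsupp.filter_apply, if_pos hj.2]

/-- **Reduction to the torus part.** On the cancellation pattern `A_S = B_S` the order at `ξ` splits as
`ord_ξ (c₁x^A + c₂x^B) = |A_S| + ord_ξ (c₁x^{A'} + c₂x^{B'})`, `A'`, `B'` the off-`S` parts. [cite: Hauser2010, §C] -/
theorem ordZero_translate_eq_degIn_add (ξ : σ → K) (S : Finset σ) (hS : ∀ i ∈ S, ξ i = 0) {A B : σ →₀ ℕ}
    (hAB : A.filter (· ∈ S) = B.filter (· ∈ S)) (c₁ c₂ : K) :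
    ordZero (aeval (fun i => X i + C (ξ i)) (monomial A c₁ + monomial B c₂)) =
      CentreBlowup.degIn S A +
        ordZero (aeval (fun i => X i + C (ξ i)) (monomial (A.filter (· ∉ S)) c₁ + monomial (B.filter (· ∉ S)) c₂)) := by
  classical
  rw [map_add, aeval_translate_monomial ξ S hS A c₁, aeval_translate_monomial ξ S hS B c₂, ← hAB, ← mul_add,
    ordZero_mul, ordZero_monomial _ one_ne_zero, degree_filter_eq_degIn, cofactor_eq_aeval_filter,
    cofactor_eq_aeval_filter, ← map_add]

omit [DecidableEq σ] in
/-- A common monomial factor supported off `S` does not change the order at `ξ`: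
`ord_ξ (x^m · H) = ord_ξ H` when `ξ` is non-zero on `supp m`. [cite: Hauser2010, §C] -/
theorem ordZero_translate_monomial_mul (ξ : σ → K) (S : Finset σ) (hS' : ∀ i, i ∉ S → ξ i ≠ 0) {m : σ →₀ ℕ}
    (hm : ∀ i ∈ S, m i = 0) (H : MvPolynomial σ K) :
    ordZero (aeval (fun i => X i + C (ξ i)) (monomial m 1 * H)) = ordZero (aeval (fun i => X i + C (ξ i)) H) := by
  have h0 : ordZero (aeval (fun i => X i + C (ξ i)) (monomial m (1 : K))) = 0 := by
    apply ordZero_eq_zero_of_constantCoeff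
    rw [constantCoeff_aeval_translate]
    exact eval_monomial_ne_zero ξ S hS' hm one_ne_zero
  rw [map_mul, ordZero_mul, h0, zero_add]

/-- Restricting to `S` kills an exponent supported off `S`. [folklore] -/
private theorem filter_mem_eq_zero_of {S : Finset σ} {F : σ →₀ ℕ} (hF : ∀ i ∈ S, F i = 0) : F.filter (· ∈ S) = 0 := by
  ext i
  rw [Finsupp.filter_apply, Finsupp.coe_zero, Pi.zero_apply]
  by_cases hi : i ∈ S
  · rw [if_pos hi, hF i hi]
  · rw [if_neg hi]

omit [DecidableEq σ] in
/-- `degIn S F = 0` for `F` supported off `S`. [folklore] -/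
private theorem degIn_eq_zero_of {S : Finset σ} {F : σ →₀ ℕ} (hF : ∀ i ∈ S, F i = 0) : CentreBlowup.degIn S F = 0 := by
  rw [CentreBlowup.degIn]; exact Finset.sum_eq_zero fun i hi => hF i hi

/-- For `F` supported off `S`, the «off-`S` product» of the earlier statements is `eval`:
`c · ∏_{j ∈ supp F, j ∉ S} ξⱼ^{Fⱼ} = (x^F · c)(ξ)`. [folklore] -/
private theorem prod_filter_eq_eval {S : Finset σ} (ξ : σ → K) {F : σ →₀ ℕ} (hF : ∀ i ∈ S, F i = 0) (c : K) :
    c * ∏ i ∈ F.support.filter (· ∉ S), ξ i ^ F i = eval ξ (monomial F c) := by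
  classical
  rw [eval_monomial, Finsupp.prod]
  congr 1
  apply Finset.prod_subset (Finset.filter_subset _ _)
  intro i hi hin
  rw [Finset.mem_filter, not_and, not_not] at hin
  have hiS := hin hi
  rw [Finsupp.mem_support_iff] at hi
  exact absurd (hF i hiS) hi

/-- The off-`S` product of `A` equals that of its off-`S` part `A'`. [folklore] -/
private theorem prod_filter_filter {S : Finset σ} (ξ : σ → K) (A : σ →₀ ℕ) :
    ∏ i ∈ (A.filter (· ∉ S)).support.filter (· ∉ S), ξ i ^ (A.filter (· ∉ S)) i =
      ∏ i ∈ A.support.filter (· ∉ S), ξ i ^ A i := by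
  classical
  have hset : (A.filter (· ∉ S)).support.filter (· ∉ S) = A.support.filter (· ∉ S) := by
    ext j; simp only [Finsupp.support_filter, Finset.mem_filter]
    tauto
  rw [hset]
  refine Finset.prod_congr rfl fun j hj => ?_
  rw [Finset.mem_filter] at hj
  rw [Finsupp.filter_apply, if_pos hj.2]

omit [DecidableEq σ] in
/-- `(x^F · c)(ξ)` through powers: `eval ξ (x^{n•F} · c) = c · (x^F(ξ))^n`. [folklore] -/
private theorem eval_monomial_nsmul (ξ : σ → K) (F : σ →₀ ℕ) (n : ℕ) (c : K) :
    eval ξ (monomial (n • F) c) = c * (eval ξ (monomial F (1 : K))) ^ n := by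
  have : monomial (n • F) c = C c * (monomial F (1 : K)) ^ n := by
    rw [monomial_pow, one_pow, C_mul_monomial, mul_one]
  rw [this, map_mul, eval_C, map_pow]

/-- **The exact jump `p^v`.** Let `A_S = B_S`, let the off-`S` parts be `A' = m + p^v F⁺`, `B' = m + p^v F⁻` with `m`, `F^±`
supported off `S` and SOME `i ∉ S` with `(F⁺ᵢ : K) ≠ F⁻ᵢ` (`p ∤ F⁺ᵢ − F⁻ᵢ`), and let the unit combination vanish at `ξ`
(`c₁ ξ^{A'} + c₂ ξ^{B'} = 0`, `c₁ ≠ 0`). Then `ord_ξ (c₁x^A + c₂x^B) = |A_S| + p^v` EXACTLY: in characteristic `p`,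
`c₁x^{p^vF⁺} + c₂x^{p^vF⁻} = c₁(x^{F⁺} − ρx^{F⁻})^{p^v}` with `ρ = ξ^{F⁺}/ξ^{F⁻}`, and the inner binomial has jump exactly one
(`ordZero_translate_binomial_eq_succ`). This is the complete size of the «toric guard» for binomial engines: a cancellation
pattern is harmless for the level-`q` top locus iff `|A_S| + p^v < q`. [cite: Hauser2010, §C] -/
theorem ordZero_translate_binomial_eq_add_pow {p : ℕ} [hp : Fact p.Prime] [CharP K p] (v : ℕ) (ξ : σ → K) (S : Finset σ)
    (hS : ∀ i ∈ S, ξ i = 0) (hS' : ∀ i, i ∉ S → ξ i ≠ 0) {A B : σ →₀ ℕ} (hAB : A.filter (· ∈ S) = B.filter (· ∈ S))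
    (m Fp Fm : σ →₀ ℕ) (hm : ∀ i ∈ S, m i = 0) (hFp : ∀ i ∈ S, Fp i = 0) (hFm : ∀ i ∈ S, Fm i = 0)
    (hA' : A.filter (· ∉ S) = m + p ^ v • Fp) (hB' : B.filter (· ∉ S) = m + p ^ v • Fm)
    {c₁ c₂ : K} (hc₁ : c₁ ≠ 0)
    (hsum : c₁ * ∏ i ∈ A.support.filter (· ∉ S), (ξ i) ^ (A i) + c₂ * ∏ i ∈ B.support.filter (· ∉ S), (ξ i) ^ (B i) = 0)
    {i : σ} (hi : i ∉ S) (hF : (Fp i : K) ≠ (Fm i : K)) :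
    ordZero (aeval (fun i => X i + C (ξ i)) (monomial A c₁ + monomial B c₂)) = (CentreBlowup.degIn S A + p ^ v : ℕ) := by
  classical
  have hA'off : ∀ j ∈ S, (A.filter (· ∉ S)) j = 0 := fun j hj => by rw [Finsupp.filter_apply, if_neg (not_not.mpr hj)]
  have hB'off : ∀ j ∈ S, (B.filter (· ∉ S)) j = 0 := fun j hj => by rw [Finsupp.filter_apply, if_neg (not_not.mpr hj)]
  -- the vanishing at ξ, as `eval`
  have hG' : eval ξ (monomial (A.filter (· ∉ S)) c₁ + monomial (B.filter (· ∉ S)) c₂) = 0 := by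
    rw [eval_add, ← prod_filter_eq_eval ξ hA'off, ← prod_filter_eq_eval ξ hB'off, prod_filter_filter, prod_filter_filter]
    exact hsum
  have hfac : monomial (m + p ^ v • Fp) c₁ + monomial (m + p ^ v • Fm) c₂ =
      monomial m (1 : K) * (monomial (p ^ v • Fp) c₁ + monomial (p ^ v • Fm) c₂) := by
    rw [mul_add, monomial_mul, monomial_mul, one_mul, one_mul]
  set ρp : K := eval ξ (monomial Fp (1 : K)) with hρp
  set ρm : K := eval ξ (monomial Fm (1 : K)) with hρm
  have hρm0 : ρm ≠ 0 := eval_monomial_ne_zero ξ S hS' hFm one_ne_zero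
  have hμ0 : eval ξ (monomial m (1 : K)) ≠ 0 := eval_monomial_ne_zero ξ S hS' hm one_ne_zero
  have hrel : c₁ * ρp ^ p ^ v + c₂ * ρm ^ p ^ v = 0 := by
    rw [hA', hB', hfac, eval_mul] at hG'
    have h2 := (mul_eq_zero.mp hG').resolve_left hμ0
    rwa [eval_add, eval_monomial_nsmul, eval_monomial_nsmul] at h2
  set ρ : K := ρp / ρm with hρ
  have hc₂ : c₂ = c₁ * (-ρ) ^ p ^ v := by
    rw [neg_pow, neg_one_pow_char_pow K p v, hρ, div_pow]
    field_simp
    linear_combination hrel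
  have hH : monomial (p ^ v • Fp) c₁ + monomial (p ^ v • Fm) c₂ =
      C c₁ * (monomial Fp (1 : K) + monomial Fm (-ρ)) ^ p ^ v := by
    rw [add_pow_char_pow, monomial_pow, monomial_pow, one_pow, mul_add, C_mul_monomial, C_mul_monomial, mul_one, ← hc₂]
  -- the inner binomial has jump exactly one
  have hinner : ordZero (aeval (fun i => X i + C (ξ i)) (monomial Fp (1 : K) + monomial Fm (-ρ))) = ((0 + 1 : ℕ) : ℕ∞) := by
    rw [← degIn_eq_zero_of hFp]
    refine ordZero_translate_binomial_eq_succ ξ S hS hS' ?_ one_ne_zero ?_ hi hF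
    · rw [filter_mem_eq_zero_of hFp, filter_mem_eq_zero_of hFm]
    · rw [prod_filter_eq_eval ξ hFp, prod_filter_eq_eval ξ hFm, ← hρp]
      have : eval ξ (monomial Fm (-ρ)) = -ρ * ρm := by
        rw [hρm, eval_monomial, eval_monomial, one_mul]
      rw [this, hρ]
      field_simp
      ring
  rw [ordZero_translate_eq_degIn_add ξ S hS hAB, hA', hB', hfac, ordZero_translate_monomial_mul ξ S hS' hm, hH, map_mul,
    map_pow, aeval_C, MvPolynomial.algebraMap_eq, ordZero_mul,
    ordZero_eq_zero_of_constantCoeff (C c₁) (by rwa [constantCoeff_C]), zero_add, ordZero_pow, hinner]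
  push_cast
  ring

/-! ## §6 (rev 4) The packaged «toric top locus» criterion under the jump-one guard -/

/-- **Toric top locus under the guard (jump-one form).** Let `G = c₁x^A + c₂x^B` (`c₁, c₂ ≠ 0`) satisfy the GUARD at level `q`:
for every cancellation pattern `S` (`A_S = B_S`) with `|A_S| < q`, one has `|A_S| + 1 < q` AND some `i ∉ S` with `(Aᵢ : K) ≠ Bᵢ`
(jump exactly one). Then at EVERY `K`-point `ξ`, with `S_ξ = {i : ξᵢ = 0}`:
`q ≤ ord_ξ G ⟺ q ≤ min(|A_{S_ξ}|, |B_{S_ξ}|)` — the top locus `{ord ≥ q}` of `z^q + G` is exactly the union of the torus-invariant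
strata `C_S` with `q ≤ min(degIn S A, degIn S B)` (`= ordAlong S G`). [cite: Hauser2010, §C] [cite: HauserPerlega2019PRIMS, §2 (ord_P)] -/
theorem natCast_le_ordZero_translate_iff_of_guard [Fintype σ] [DecidableEq K] (q : ℕ) {A B : σ →₀ ℕ} {c₁ c₂ : K} (hc₁ : c₁ ≠ 0) (hc₂ : c₂ ≠ 0)
    (hguard : ∀ S : Finset σ, A.filter (· ∈ S) = B.filter (· ∈ S) → CentreBlowup.degIn S A < q →
      CentreBlowup.degIn S A + 1 < q ∧ ∃ i, i ∉ S ∧ (A i : K) ≠ (B i : K))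
    (ξ : σ → K) :
    (q : ℕ∞) ≤ ordZero (aeval (fun i => X i + C (ξ i)) (monomial A c₁ + monomial B c₂)) ↔
      q ≤ min (CentreBlowup.degIn (Finset.univ.filter fun i => ξ i = 0) A)
        (CentreBlowup.degIn (Finset.univ.filter fun i => ξ i = 0) B) := by
  classical
  set S : Finset σ := Finset.univ.filter fun i => ξ i = 0 with hSdef
  have hS : ∀ i ∈ S, ξ i = 0 := fun i hi => by rw [hSdef, Finset.mem_filter] at hi; exact hi.2
  have hS' : ∀ i, i ∉ S → ξ i ≠ 0 := fun i hi h0 => hi (by rw [hSdef, Finset.mem_filter]; exact ⟨Finset.mem_univ _, h0⟩)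
  by_cases hAB : A.filter (· ∈ S) = B.filter (· ∈ S)
  · -- cancellation pattern: `|A_S| = |B_S|`
    have hdeg : CentreBlowup.degIn S A = CentreBlowup.degIn S B := by
      rw [← degree_filter_eq_degIn, ← degree_filter_eq_degIn, hAB]
    rw [← hdeg, min_self]
    by_cases hsum : c₁ * ∏ i ∈ A.support.filter (· ∉ S), (ξ i) ^ (A i) +
        c₂ * ∏ i ∈ B.support.filter (· ∉ S), (ξ i) ^ (B i) = 0
    · -- on the cancellation hypersurface: the order is `|A_S| + 1` or at least that
      by_cases hlt : CentreBlowup.degIn S A < q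
      · obtain ⟨hlt2, i, hi, hABi⟩ := hguard S hAB hlt
        rw [ordZero_translate_binomial_eq_succ ξ S hS hS' hAB hc₁ hsum hi hABi, Nat.cast_le]
        omega
      · push Not at hlt
        constructor
        · intro _; exact_mod_cast hlt
        · intro _
          exact le_trans (by exact_mod_cast Nat.le_succ_of_le hlt)
            (succ_degIn_le_ordZero_translate_of_sum_eq_zero ξ S hS hAB c₁ c₂ hsum)
    · rw [ordZero_translate_binomial_eq_of_sum_ne_zero ξ S hS hAB c₁ c₂ hsum, Nat.cast_le]
  · -- no cancellation: the order is the minimum exactly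
    rcases le_total (CentreBlowup.degIn S A) (CentreBlowup.degIn S B) with hle | hle
    · rw [ordZero_translate_binomial_eq ξ S hS hS' hAB hle hc₁, min_eq_left hle, Nat.cast_le]
    · rw [add_comm (monomial A c₁), ordZero_translate_binomial_eq ξ S hS hS' (Ne.symm hAB) hle hc₂, min_eq_right hle,
        Nat.cast_le]

/-! ## §7 (rev 5) A decidable sufficient condition for the guard: one coordinate with `Aᵢ ≠ Bᵢ` in `K` and small
«agreement mass» -/

/-- On a cancellation pattern `S` (`A_S = B_S`) every index of `S` is an AGREEING coordinate (`Aᵢ = Bᵢ`), so `|A_S|` is at most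
the «agreement mass» `Σ_{i : Aᵢ = Bᵢ} Aᵢ` of the pair. [cite: Hauser2010, §C] -/
theorem degIn_le_agreementMass_of_filter_eq [Fintype σ] {A B : σ →₀ ℕ} {S : Finset σ}
    (hfil : A.filter (· ∈ S) = B.filter (· ∈ S)) :
    CentreBlowup.degIn S A ≤ ∑ i, if A i = B i then A i else 0 := by
  classical
  have hagree : ∀ i ∈ S, A i = B i := fun i hi => by
    have e := congrArg (fun f => f i) hfil
    simpa only [Finsupp.filter_apply, if_pos hi] using e
  rw [CentreBlowup.degIn]
  conv_lhs => rw [← Finset.univ_inter S]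
  rw [← Finset.sum_ite_mem Finset.univ S]
  refine Finset.sum_le_sum fun i _ => ?_
  by_cases hi : i ∈ S
  · rw [if_pos hi, if_pos (hagree i hi)]
  · rw [if_neg hi]; exact Nat.zero_le _

/-- **The guard from two decidable facts.** If SOME coordinate `i₀` has `(A i₀ : K) ≠ B i₀` (in characteristic `p`: `p ∤ A i₀ − B i₀`;
such an `i₀` lies outside every cancellation pattern) and the agreement mass satisfies `Σ_{i : Aᵢ = Bᵢ} Aᵢ + 1 < q`, then the
jump-one guard of `natCast_le_ordZero_translate_iff_of_guard` holds at level `q`. (Both hypotheses are `decide`-able on explicit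
exponents; this is the form used on the RESCUE bed's binomial members.) [cite: Hauser2010, §C] -/
theorem guard_of_apply_ne [Fintype σ] (q : ℕ) {A B : σ →₀ ℕ} (i₀ : σ) (hi₀ : (A i₀ : K) ≠ (B i₀ : K))
    (hmass : (∑ i, if A i = B i then A i else 0) + 1 < q) :
    ∀ S : Finset σ, A.filter (· ∈ S) = B.filter (· ∈ S) → CentreBlowup.degIn S A < q →
      CentreBlowup.degIn S A + 1 < q ∧ ∃ i, i ∉ S ∧ (A i : K) ≠ (B i : K) := by
  classical
  intro S hfil _
  have hagree : ∀ i ∈ S, A i = B i := fun i hi => by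
    have e := congrArg (fun f => f i) hfil
    simpa only [Finsupp.filter_apply, if_pos hi] using e
  have hi₀S : i₀ ∉ S := fun h => hi₀ (by rw [hagree i₀ h])
  exact ⟨lt_of_le_of_lt (Nat.add_le_add_right (degIn_le_agreementMass_of_filter_eq hfil) 1) hmass, i₀, hi₀S, hi₀⟩

/-- **Toric top locus from two decidable facts** (`natCast_le_ordZero_translate_iff_of_guard` ∘ `guard_of_apply_ne`): for
`G = c₁x^A + c₂x^B` (`c₁, c₂ ≠ 0`) with some `(A i₀ : K) ≠ B i₀` and agreement mass `Σ_{i : Aᵢ = Bᵢ} Aᵢ + 1 < q`, at EVERY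
`K`-point `ξ`: `q ≤ ord_ξ G ⟺ q ≤ min(|A_{S_ξ}|, |B_{S_ξ}|)`, `S_ξ = {i : ξᵢ = 0}` — the top locus `{ord ≥ q}` of `z^q + G` is
exactly the union of the torus-invariant strata with `q ≤ ordAlong`. [cite: Hauser2010, §C] [cite: HauserPerlega2019PRIMS, §2 (ord_P)] -/
theorem natCast_le_ordZero_translate_iff_of_apply_ne [Fintype σ] [DecidableEq K] (q : ℕ) {A B : σ →₀ ℕ} {c₁ c₂ : K}
    (hc₁ : c₁ ≠ 0) (hc₂ : c₂ ≠ 0) (i₀ : σ) (hi₀ : (A i₀ : K) ≠ (B i₀ : K))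
    (hmass : (∑ i, if A i = B i then A i else 0) + 1 < q) (ξ : σ → K) :
    (q : ℕ∞) ≤ ordZero (aeval (fun i => X i + C (ξ i)) (monomial A c₁ + monomial B c₂)) ↔
      q ≤ min (CentreBlowup.degIn (Finset.univ.filter fun i => ξ i = 0) A)
        (CentreBlowup.degIn (Finset.univ.filter fun i => ξ i = 0) B) :=
  natCast_le_ordZero_translate_iff_of_guard q hc₁ hc₂ (guard_of_apply_ne q i₀ hi₀ hmass) ξ

end BinomialPointOrder

end Literature.AlgebraicGeometry.Resolution

end
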